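import Summits.BirchSwinnertonDyer.BirchSwinnertonDyer.Theses.PlecticLegs
import Summits.BirchSwinnertonDyer.BirchSwinnertonDyer.Theorems.PlecticLegsPlecticPointsLBStubFactorOrders
import Summits.BirchSwinnertonDyer.BirchSwinnertonDyer.Theorems.PlecticLegsPlecticPointsLBStubBalancedChart
import Literature.NumberTheory.EllipticCurves.AnalyticRank
import Literature.NumberTheory.EllipticCurves.QuadraticTwist
import HarnessLib

/-!
# Tightness of the atlas stub of line `conjugate-pigeonhole` (crux `PlecticLegs.PlecticPointsLB`,
# stmt-BirchSwinnertonDyer-17518): the transfer stub is the crux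

Lead prover's death certificate for the line (seat `prover-line-stmt-BirchSwinnertonDyer-17518-0`,
2026-08-17).  The registered skeleton `Lines/sketch_conjugate_pigeonhole.lean` reduces the crux to three stubs
A (`stub_factorOrders`, landed), B (`stub_balancedChart`) and T (`stub_atlas`).  T asks, for every `(F, V)` in
the plectic regime, EITHER for the balanced quadratic chart data OR for a factorisation of `V.entireLFunction`
on `Re s > 3/2` into `[F:ℚ]` entire factors all vanishing at `s = 1` TOGETHER WITH the order-one engine
"every factor of exact order one ⇒ `[F:ℚ] ≤ rank`".

This file proves, sorry-free:

* `exists_vanishing_factorisation` — for ANY Weierstrass curve `V` over a number field whose L-function has an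
  entire continuation and ANY `d ≥ 1` with `V.analyticRank = d`, the factorisation clauses of T hold for free:
  `V.entireLFunction = ∏_{i : Fin d} gᵢ` globally with `g₀ = L(V,s)/(s-1)^{d-1}` (removable singularity) and
  `gᵢ = s - 1` (`i ≥ 1`), all entire, all vanishing at `1`.  No arithmetic enters.
* `stub_atlas_of_plecticPointsLB` — consequently the crux `PlecticPointsLB` implies T's factorisation disjunct
  for every plectic-regime curve with an entire L-function (the engine clause is then the crux's own conclusion).
* `plecticPointsLB_of_stub_atlas` — the skeleton's composition with stub A discharged by the LANDED theorem
  `Summit.BirchSwinnertonDyer.BirchSwinnertonDyer.Theorems.stub_factorOrders` (p148795): `T → (B → crux)`;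
  `plecticPointsLB_of_stub_atlas'` — the same with B discharged too (`…Theorems.stub_balancedChart`, p149951):
  `T → crux` unconditionally.

Together with the skeleton's `PlecticPointsLB_of : A → B → T → PlecticPointsLB` this sandwiches T between the
crux and the crux restricted to curves with entire `L` — and every curve in the plectic regime has entire `L`
(the hypothesis `V.analyticRank = [F:ℚ] ≥ 2` is the order of vanishing of a CONTINUED L-function; in the tree's
typing the junk branch of `entireLFunction` is excluded on paper, refuter birth audit 2026-08-17).  So T is
crux-equivalent: the abstract "factorisation + engine" formulation carries no arithmetic, and the line's
mathematical content (Galois-rigid ARITHMETIC factorisations: restriction of scalars of GL₂-type, balanced base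
change) covers only the charts (RM) ∪ (BAL), not automorphically primitive `V` nor the unbalanced silent base
changes that are all the instances the route's `closes` feeds in.  Hence `line-dead` (Lines/…dead.md).
-/

set_option linter.dupNamespace false -- `Summit.BirchSwinnertonDyer.BirchSwinnertonDyer.…`: single-conjunct summit (D-0017)

namespace Summit.BirchSwinnertonDyer.BirchSwinnertonDyer.Cruxes.PlecticPointsLB.ConjugatePigeonhole

open Filter Topology
open Summit.BirchSwinnertonDyer.BirchSwinnertonDyer.Theses.PlecticLegs

/-- **Removable-singularity division by `(z-1)^(d-1)`.** An entire `f : ℂ → ℂ` with `analyticOrderAt f 1 = d`,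
`d ≥ 1`, factors GLOBALLY as `f z = (z - 1)^(d-1) · g z` with `g` entire and `g 1 = 0`
(`g = f/(z-1)^{d-1}` off `1`, extended by `0`). [folklore] -/
theorem exists_eq_pow_mul_of_analyticOrderAt {f : ℂ → ℂ} (hf : Differentiable ℂ f) {d : ℕ} (hd : 1 ≤ d)
    (hord : analyticOrderAt f 1 = d) :
    ∃ g : ℂ → ℂ, Differentiable ℂ g ∧ (∀ z, f z = (z - 1) ^ (d - 1) * g z) ∧ g 1 = 0 := by
  obtain ⟨G, hGan, hG1, hfG⟩ := ((hf.analyticAt 1).analyticOrderAt_eq_natCast).mp hord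
  -- the candidate: `f / (z-1)^(d-1)` off `1`, value `0` at `1`
  refine ⟨fun z => if z = 1 then 0 else f z / (z - 1) ^ (d - 1), ?_, ?_, by simp⟩
  · intro z₀
    by_cases hz₀ : z₀ = 1
    · -- at `1`: the candidate agrees near `1` with `(z - 1) • G z`, which is analytic at `1`
      subst hz₀
      have hev : (fun z => if z = 1 then 0 else f z / (z - 1) ^ (d - 1)) =ᶠ[𝓝 (1 : ℂ)]
          fun z => (z - 1) * G z := by
        filter_upwards [hfG] with z hz
        by_cases h1 : z = 1
        · simp [h1]
        · rw [if_neg h1, hz, smul_eq_mul]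
          have hz1 : (z - 1) ≠ 0 := sub_ne_zero.mpr h1
          have hpow : (z - 1) ^ d = (z - 1) ^ (d - 1) * (z - 1) := by
            rw [← pow_succ, Nat.sub_add_cancel hd]
          rw [hpow]
          field_simp
      refine (hev.differentiableAt_iff).mpr ?_
      exact ((differentiableAt_id.sub_const 1).mul hGan.differentiableAt)
    · -- off `1`: the candidate agrees near `z₀` with the quotient, differentiable since `(z-1)^(d-1) ≠ 0`
      have hev : (fun z => if z = 1 then 0 else f z / (z - 1) ^ (d - 1)) =ᶠ[𝓝 z₀]
          fun z => f z / (z - 1) ^ (d - 1) := by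
        filter_upwards [eventually_ne_nhds hz₀] with z hz
        rw [if_neg hz]
      refine (hev.differentiableAt_iff).mpr ?_
      exact (hf z₀).div (by fun_prop) (pow_ne_zero _ (sub_ne_zero.mpr hz₀))
  · intro z
    by_cases h1 : z = 1
    · subst h1
      have h0 : f 1 = 0 := by
        have := hfG.self_of_nhds
        simpa [zero_pow (Nat.one_le_iff_ne_zero.mp hd)] using this
      simp [h0]
    · simp only [if_neg h1]
      have hz1 : (z - 1) ^ (d - 1) ≠ 0 := pow_ne_zero _ (sub_ne_zero.mpr h1)
      field_simp

/-- **The factorisation clauses of the atlas stub are free.** For a Weierstrass curve `V` over a number field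
whose L-function has an entire continuation and `V.analyticRank = d ≥ 1`, there are `d` ENTIRE functions
`g₀, …, g_{d-1}`, ALL vanishing at `s = 1`, with `V.entireLFunction = ∏ gᵢ` everywhere (hence on `Re s > 3/2`):
`g₀ = L(V,s)/(s-1)^{d-1}`, `gᵢ = s - 1` for `i ≥ 1`.  No arithmetic of `V` is used. [folklore] -/
theorem exists_vanishing_factorisation {F : Type} [Field F] [NumberField F] (V : WeierstrassCurve F)
    (hV : V.HasEntireLFunction) {d : ℕ} (hd : 1 ≤ d) (hr : V.analyticRank = d) :
    ∃ g : Fin d → ℂ → ℂ, (∀ i, Differentiable ℂ (g i)) ∧ (∀ s, V.entireLFunction s = ∏ i, g i s) ∧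
      (∀ i, g i 1 = 0) := by
  have hf : Differentiable ℂ V.entireLFunction := V.differentiable_entireLFunction hV
  -- `analyticRank = d ≥ 1` pins the `ℕ∞`-valued order to `d`
  have htop : analyticOrderAt V.entireLFunction 1 ≠ ⊤ := by
    intro htop
    have : V.analyticRank = 0 := by
      simp [WeierstrassCurve.analyticRank, analyticOrderNatAt, htop]
    omega
  have hord : analyticOrderAt V.entireLFunction 1 = d := by
    rw [← Nat.cast_analyticOrderNatAt htop]
    exact_mod_cast hr
  obtain ⟨g₀, hg₀, hfac, hg₀1⟩ := exists_eq_pow_mul_of_analyticOrderAt hf hd hord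
  obtain ⟨k, rfl⟩ : ∃ k, d = k + 1 := ⟨d - 1, by omega⟩
  refine ⟨Fin.cons g₀ (fun _ z => z - 1), ?_, ?_, ?_⟩
  · refine Fin.cases ?_ (fun i => ?_)
    · simpa using hg₀
    · simp only [Fin.cons_succ]
      fun_prop
  · intro s
    rw [Fin.prod_univ_succ]
    simp only [Fin.cons_zero, Fin.cons_succ, Finset.prod_const, Finset.card_univ, Fintype.card_fin]
    rw [hfac s, mul_comm]
    simp
  · refine Fin.cases ?_ (fun i => ?_)
    · simpa using hg₀1
    · simp

/-- **The atlas stub T is implied by the crux on curves with entire `L`** (death certificate of the line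
`conjugate-pigeonhole`): assuming `PlecticPointsLB`, every plectic-regime `(F, V)` with `V.HasEntireLFunction`
satisfies the factorisation disjunct of `stub_atlas` verbatim — the factorisation by
`exists_vanishing_factorisation`, the engine clause by the crux itself.  With the skeleton's
`PlecticPointsLB_of : stub_factorOrders → stub_balancedChart → stub_atlas → PlecticPointsLB` this shows T is
crux-equivalent (modulo continuation of `L(V/F,s)`, which the regime hypothesis presupposes). [folklore] -/
theorem stub_atlas_of_plecticPointsLB (h : PlecticPointsLB) :
    ∀ (F : Type) [Field F] [NumberField F] [NumberField.IsTotallyReal F] (V : WeierstrassCurve F)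
      [V.IsElliptic], V.HasEntireLFunction → 2 ≤ Module.finrank ℚ F → V.analyticRank = Module.finrank ℚ F →
      (∃ W : WeierstrassCurve ℚ, W.IsElliptic ∧ Module.finrank ℚ F = 2 ∧ V = W.baseChange F ∧
          W.HasEntireLFunction ∧ (W.quadraticTwist (NumberField.discr F : ℚ)).HasEntireLFunction ∧
          W.entireLFunction 1 = 0 ∧ (W.quadraticTwist (NumberField.discr F : ℚ)).entireLFunction 1 = 0 ∧
          (W.analyticRank ≤ 1 → W.analyticRank = W.mordellWeilRank) ∧
          ((W.quadraticTwist (NumberField.discr F : ℚ)).analyticRank ≤ 1 →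
            (W.quadraticTwist (NumberField.discr F : ℚ)).analyticRank =
              (W.quadraticTwist (NumberField.discr F : ℚ)).mordellWeilRank)) ∨
      (∃ g : Fin (Module.finrank ℚ F) → ℂ → ℂ,
        (∀ i, Differentiable ℂ (g i)) ∧
        (∀ s : ℂ, (3 / 2 : ℝ) < s.re → V.entireLFunction s = ∏ i, g i s) ∧
        (∀ i, g i 1 = 0) ∧
        ((∀ i, analyticOrderAt (g i) 1 = 1) → Module.finrank ℚ F ≤ V.mordellWeilRank)) := by
  intro F _ _ _ V _ hV hd hr
  obtain ⟨g, hg, hfac, hz⟩ := exists_vanishing_factorisation V hV (by omega) hr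
  exact Or.inr ⟨g, hg, fun s _ => hfac s, hz, fun _ => h F V hd hr⟩

/-- **The engine clause alone is the crux (on curves with entire `L`).** Equivalent reading of the previous
theorem with the factorisation made explicit: for a plectic-regime `(F, V)` with entire `L`, the trivial
factorisation `g₀ = L/(s-1)^{d-1}`, `gᵢ = s-1` has every factor of exact order one as soon as it has the right
total order (`stub_factorOrders`), so an "order-one engine" valid for ALL factorisations restates
`[F:ℚ] ≤ rank_ℤ V(F)`.  Recorded as the implication used in `Lines/sketch_conjugate_pigeonhole.dead.md`:
if every all-vanishing entire factorisation of `L(V/F,s)` into `[F:ℚ]` factors carried the engine, the crux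
would follow for that `V` — i.e. supplying the engine universally is supplying the crux. [folklore] -/
theorem plecticPointsLB_pointwise_of_universal_engine {F : Type} [Field F] [NumberField F]
    (V : WeierstrassCurve F) (hV : V.HasEntireLFunction) (hd : 2 ≤ Module.finrank ℚ F)
    (hr : V.analyticRank = Module.finrank ℚ F)
    (hengine : ∀ g : Fin (Module.finrank ℚ F) → ℂ → ℂ, (∀ i, Differentiable ℂ (g i)) →
      (∀ s : ℂ, (3 / 2 : ℝ) < s.re → V.entireLFunction s = ∏ i, g i s) → (∀ i, g i 1 = 0) →
      Module.finrank ℚ F ≤ V.mordellWeilRank) :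
    Module.finrank ℚ F ≤ V.mordellWeilRank := by
  obtain ⟨g, hg, hfac, hz⟩ := exists_vanishing_factorisation V hV (by omega) hr
  exact hengine g hg (fun s _ => hfac s) hz

/-! ## The other direction (the skeleton's composition, with the LANDED stub A) -/

/-- **Converse packaging: T ⇒ (B ⇒ crux)**, i.e. the skeleton's `PlecticPointsLB_of` with stub A discharged by
the landed theorem `Summit.BirchSwinnertonDyer.BirchSwinnertonDyer.Theorems.stub_factorOrders` (p148795) and
stub B kept as a hypothesis (its own Theorems file lands separately).  Together with
`stub_atlas_of_plecticPointsLB` this file alone exhibits the sandwich `crux|_{entire L} ⇐ T ⇒ (B ⇒ crux)`,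
with B a GZK-calibration statement at `d = 2` — so the transfer stub T carries the whole crux. [folklore] -/
theorem plecticPointsLB_of_stub_atlas
    (hB : ∀ (W : WeierstrassCurve ℚ) [W.IsElliptic] (K : Type) [Field K] [NumberField K],
      Module.finrank ℚ K = 2 →
      W.HasEntireLFunction → (W.quadraticTwist (NumberField.discr K : ℚ)).HasEntireLFunction →
      W.entireLFunction 1 = 0 → (W.quadraticTwist (NumberField.discr K : ℚ)).entireLFunction 1 = 0 →
      (W.analyticRank ≤ 1 → W.analyticRank = W.mordellWeilRank) →
      ((W.quadraticTwist (NumberField.discr K : ℚ)).analyticRank ≤ 1 →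
        (W.quadraticTwist (NumberField.discr K : ℚ)).analyticRank =
          (W.quadraticTwist (NumberField.discr K : ℚ)).mordellWeilRank) →
      (W.baseChange K).analyticRank = 2 → 2 ≤ (W.baseChange K).mordellWeilRank)
    (hT : ∀ (F : Type) [Field F] [NumberField F] [NumberField.IsTotallyReal F] (V : WeierstrassCurve F)
      [V.IsElliptic], 2 ≤ Module.finrank ℚ F → V.analyticRank = Module.finrank ℚ F →
      (∃ W : WeierstrassCurve ℚ, W.IsElliptic ∧ Module.finrank ℚ F = 2 ∧ V = W.baseChange F ∧
          W.HasEntireLFunction ∧ (W.quadraticTwist (NumberField.discr F : ℚ)).HasEntireLFunction ∧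
          W.entireLFunction 1 = 0 ∧ (W.quadraticTwist (NumberField.discr F : ℚ)).entireLFunction 1 = 0 ∧
          (W.analyticRank ≤ 1 → W.analyticRank = W.mordellWeilRank) ∧
          ((W.quadraticTwist (NumberField.discr F : ℚ)).analyticRank ≤ 1 →
            (W.quadraticTwist (NumberField.discr F : ℚ)).analyticRank =
              (W.quadraticTwist (NumberField.discr F : ℚ)).mordellWeilRank)) ∨
      (∃ g : Fin (Module.finrank ℚ F) → ℂ → ℂ,
        (∀ i, Differentiable ℂ (g i)) ∧
        (∀ s : ℂ, (3 / 2 : ℝ) < s.re → V.entireLFunction s = ∏ i, g i s) ∧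
        (∀ i, g i 1 = 0) ∧
        ((∀ i, analyticOrderAt (g i) 1 = 1) → Module.finrank ℚ F ≤ V.mordellWeilRank))) :
    PlecticPointsLB := by
  intro F _ _ _ V _ hd hran
  rcases hT F V hd hran with ⟨W, hW, h2, hV, hWe, hWde, hW0, hWd0, hg1, hg2⟩ | ⟨g, hg, hfac, hz, heng⟩
  · haveI := hW
    subst hV
    rw [h2] at hran ⊢
    exact hB W F h2 hWe hWde hW0 hWd0 hg1 hg2 hran
  · exact heng (Summit.BirchSwinnertonDyer.BirchSwinnertonDyer.Theorems.stub_factorOrders F V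
      (Module.finrank ℚ F) g (by omega) hg hfac hz hran)

/-- **T ⇒ crux, unconditionally** — the skeleton's composition with BOTH closable stubs discharged by their
landed Theorems (`stub_factorOrders`, p148795; `stub_balancedChart`, p149951).  With
`stub_atlas_of_plecticPointsLB` (crux ⇒ T on curves with entire `L`) this is the kernel-checked statement that
the registered transfer stub of line `conjugate-pigeonhole` is exactly as hard as the crux. [folklore] -/
theorem plecticPointsLB_of_stub_atlas'
    (hT : ∀ (F : Type) [Field F] [NumberField F] [NumberField.IsTotallyReal F] (V : WeierstrassCurve F)
      [V.IsElliptic], 2 ≤ Module.finrank ℚ F → V.analyticRank = Module.finrank ℚ F →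
      (∃ W : WeierstrassCurve ℚ, W.IsElliptic ∧ Module.finrank ℚ F = 2 ∧ V = W.baseChange F ∧
          W.HasEntireLFunction ∧ (W.quadraticTwist (NumberField.discr F : ℚ)).HasEntireLFunction ∧
          W.entireLFunction 1 = 0 ∧ (W.quadraticTwist (NumberField.discr F : ℚ)).entireLFunction 1 = 0 ∧
          (W.analyticRank ≤ 1 → W.analyticRank = W.mordellWeilRank) ∧
          ((W.quadraticTwist (NumberField.discr F : ℚ)).analyticRank ≤ 1 →
            (W.quadraticTwist (NumberField.discr F : ℚ)).analyticRank =
              (W.quadraticTwist (NumberField.discr F : ℚ)).mordellWeilRank)) ∨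
      (∃ g : Fin (Module.finrank ℚ F) → ℂ → ℂ,
        (∀ i, Differentiable ℂ (g i)) ∧
        (∀ s : ℂ, (3 / 2 : ℝ) < s.re → V.entireLFunction s = ∏ i, g i s) ∧
        (∀ i, g i 1 = 0) ∧
        ((∀ i, analyticOrderAt (g i) 1 = 1) → Module.finrank ℚ F ≤ V.mordellWeilRank))) :
    PlecticPointsLB :=
  plecticPointsLB_of_stub_atlas Summit.BirchSwinnertonDyer.BirchSwinnertonDyer.Theorems.stub_balancedChart hT

end Summit.BirchSwinnertonDyer.BirchSwinnertonDyer.Cruxes.PlecticPointsLB.ConjugatePigeonhole
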